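import Literature.Barriers.ABC.BakerMethodBounds
import Literature.Barriers.ABC.BakerMethodBoundsThreeRoutesProofs
import HarnessLib

/-!
# Proofs for `BakerMethodBounds`, II: Stewart–Yu's Theorem 1 from linear forms in logarithms

`Literature/Barriers/ABC/BakerMethodBoundsStewartYuProofs.lean` — proofs companion of the barrier
file `Literature/Barriers/ABC/BakerMethodBounds.lean` (theorems only, no definitions), completing
`BakerMethodBoundsThreeRoutesProofs.lean` (see its module docstring for the sources, the
architecture, and what is a reconstruction). Main results:

* `bakerShapeBound_third_three_of_approximationBound`: `PastenApproximationBound K` with `K ≥ 1`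
  (lower bounds for linear forms in complex and `p`-adic logarithms over `ℚ`, Pasten's
  Theorem 2.1 [cite: Pasten2024, Theorem 2.1]) implies `BakerShapeBound (1/3) 3`, i.e. an absolute
  `κ` with `log c ≤ κ R^{1/3} (log R)³` for every abc triple — the statement of Stewart–Yu 2001,
  Theorem 1 [cite: StewartYu2001, Theorem 1];
* `BakerMethodBounds_of_evertseGyory : evertseGyory_thm_4_2_1_rat → BakerMethodBounds` and
  `stewart_yu_of_evertseGyory : evertseGyory_thm_4_2_1_rat → stewart_yu` (`abc.S06`): the
  undischarged trust base of the barrier declaration (and of `AbcWave0`'s `stewart_yu`) is exactly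
  the named fact Evertse–Győry, Theorem 4.2.1 over `ℚ` [cite: EvertseGyory2015, Theorem 4.2.1 (p. 68)].
  The discharge `BakerMethodBounds_holds` is therefore out of reach only through that fact
  (Matveev's and Yu's theorems and Evertse–Győry's Proposition 4.4.1 are not in Mathlib).
* `stewartYu1991_of_stewartYu : stewart_yu → stewartYu1991_upperBound` and
  `stewartYu1991_of_evertseGyory : evertseGyory_thm_4_2_1_rat → stewartYu1991_upperBound`: the
  1991 shape `κ(ε) R^{2/3+ε}` [cite: Waldschmidt2014, §2 (PDF p. 3)] follows from the 2001 shape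
  `κ R^{1/3} (log R)³` by the elementary `(log R)³ ≤ 9³ R^{1/3}` (`R ≥ 1`), so every named fact of
  the barrier file (`stewartTijdeman1986_upperBound`, `stewartYu1991_upperBound`,
  `BakerMethodBounds` = `stewart_yu`) has the same single undischarged input.

Steps of this file (numbering of the companion's docstring): 3a `cube_combine`/`log_pow_three_le`
— `(log c)³ ≤ 64 K⁹ C³ Λ⁶ Y³ R` with `Λ = max(1, log R)`, `Y = log max{e, 2 log c}`;
3b `le_of_cube_le` — cube root and the self-improvement `le_of_le_mul_log_max`, giving
`log c ≤ 64K³C(log(16K³C) + 3) · R^{1/3}(log R)³`; the triple `1 + 1 = 2` (no route through `c`)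
is checked numerically (`κ ≥ 192`, `R = 2`).

## References

* [StewartYu2001] C. L. Stewart, K. Yu, *On the abc conjecture, II*, Duke Math. J. 108 (2001),
  169–181 — Theorem 1.
* [EvertseGyory2015] J.-H. Evertse, K. Győry, *Unit Equations in Diophantine Number Theory*,
  CUP 2015 — Theorem 4.2.1 (p. 68).
* [Pasten2024] H. Pasten, Invent. Math. 236 (2024), 373–385 — Theorem 2.1.
-/

noncomputable section

open Finset Real Height
open Literature.NumberTheory.DiophantineGeometry
open Literature.NumberTheory.DiophantineGeometry.Dioph
open Literature.NumberTheory.DiophantineGeometry.Pasten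

namespace Literature.Barriers.ABC

/-! ### Self-improvement -/

/-- Self-improvement: `y ≤ M · log max{e, 2y}` with `M ≥ 1` forces `y ≤ 2 M log(4M)`.
[folklore] -/
theorem le_of_le_mul_log_max {y M : ℝ} (hM : 1 ≤ M)
    (h : y ≤ M * Real.log (max (Real.exp 1) (2 * y))) : y ≤ 2 * M * Real.log (4 * M) := by
  have hM0 : 0 < M := lt_of_lt_of_le one_pos hM
  have hlog4M : 1 ≤ Real.log (4 * M) := by
    rw [← Real.log_exp 1]
    apply Real.log_le_log (Real.exp_pos 1)
    have := Real.exp_one_lt_d9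
    nlinarith
  rcases le_or_gt (2 * y) (Real.exp 1) with h2 | h2
  · rw [max_eq_left h2, Real.log_exp] at h
    nlinarith
  · rw [max_eq_right h2.le] at h
    have hu0 : 0 < 2 * y := (Real.exp_pos 1).trans h2
    have hlog : Real.log (2 * y) ≤ 2 * y / (4 * M) - 1 + Real.log (4 * M) := by
      have h1 : Real.log (2 * y) = Real.log (2 * y / (4 * M)) + Real.log (4 * M) := by
        rw [Real.log_div hu0.ne' (by positivity)]; ring
      have h2 := Real.log_le_sub_one_of_pos (show 0 < 2 * y / (4 * M) by positivity)
      linarith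
    have key : y ≤ M * (2 * y / (4 * M) - 1 + Real.log (4 * M)) :=
      h.trans (mul_le_mul_of_nonneg_left hlog hM0.le)
    have hsimp : M * (2 * y / (4 * M) - 1 + Real.log (4 * M)) = y / 2 - M + M * Real.log (4 * M) := by
      field_simp
      ring
    rw [hsimp] at key
    nlinarith

/-! ### Assembly -/

section Assembly

variable {K : ℝ}

/-- **The cube of the three routes** (pure algebra): from the three route bounds and the three
per-member accountings, `y³ ≤ K³ Y³ · B_a B_b B_c`. [folklore] -/
theorem cube_combine {Y y La Lb Lc sa sb sc Ba Bb Bc : ℝ} {ta tb tc : ℕ}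
    (hK : 0 ≤ K) (hy : 0 ≤ y) (hY : 0 ≤ Y) (hsa : 0 ≤ sa) (hsb : 0 ≤ sb) (hsc : 0 ≤ sc)
    (hA : y < K ^ (tb + tc + 1) * (Lb * Lc) * Y * (1 + 3 * sa))
    (hB : y < K ^ (ta + tc + 1) * (La * Lc) * Y * (1 + 3 * sb))
    (hC : y < K ^ (ta + tb + 1) * (La * Lb) * Y * (1 + 3 * sc))
    (hXa : K ^ (2 * ta) * La ^ 2 * (1 + 3 * sa) ≤ Ba)
    (hXb : K ^ (2 * tb) * Lb ^ 2 * (1 + 3 * sb) ≤ Bb)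
    (hXc : K ^ (2 * tc) * Lc ^ 2 * (1 + 3 * sc) ≤ Bc) :
    y ^ 3 ≤ K ^ 3 * Y ^ 3 * (Ba * Bb * Bc) := by
  have hXa0 : 0 ≤ K ^ (2 * ta) * La ^ 2 * (1 + 3 * sa) := by positivity
  have hXb0 : 0 ≤ K ^ (2 * tb) * Lb ^ 2 * (1 + 3 * sb) := by positivity
  have hXc0 : 0 ≤ K ^ (2 * tc) * Lc ^ 2 * (1 + 3 * sc) := by positivity
  have hA0 : 0 ≤ K ^ (tb + tc + 1) * (Lb * Lc) * Y * (1 + 3 * sa) := hy.trans hA.le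
  have hB0 : 0 ≤ K ^ (ta + tc + 1) * (La * Lc) * Y * (1 + 3 * sb) := hy.trans hB.le
  have hcube : y ^ 3 ≤ (K ^ (tb + tc + 1) * (Lb * Lc) * Y * (1 + 3 * sa)) *
      (K ^ (ta + tc + 1) * (La * Lc) * Y * (1 + 3 * sb)) *
      (K ^ (ta + tb + 1) * (La * Lb) * Y * (1 + 3 * sc)) := by
    rw [pow_three']
    exact mul_le_mul (mul_le_mul hA.le hB.le hy hA0) hC.le hy (mul_nonneg hA0 hB0)
  have hident : (K ^ (tb + tc + 1) * (Lb * Lc) * Y * (1 + 3 * sa)) *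
      (K ^ (ta + tc + 1) * (La * Lc) * Y * (1 + 3 * sb)) *
      (K ^ (ta + tb + 1) * (La * Lb) * Y * (1 + 3 * sc)) =
      K ^ 3 * Y ^ 3 * ((K ^ (2 * ta) * La ^ 2 * (1 + 3 * sa)) *
        (K ^ (2 * tb) * Lb ^ 2 * (1 + 3 * sb)) * (K ^ (2 * tc) * Lc ^ 2 * (1 + 3 * sc))) := by
    ring
  rw [hident] at hcube
  refine hcube.trans (mul_le_mul_of_nonneg_left ?_ (by positivity))
  exact mul_le_mul (mul_le_mul hXa hXb hXb0 (hXa0.trans hXa)) hXc hXc0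
    (mul_nonneg (hXa0.trans hXa) (hXb0.trans hXb))

/-- **The cube of the three routes for an abc triple** with `ab > 1`:
`(log c)³ ≤ 64 K⁹ C³ Λ⁶ Y³ R`, where `R = rad(abc)`, `Λ = max(1, log R)`,
`Y = log max{e, 2 log c}` and `C` bounds the products `∏ 4K²(log p)²/p` over finite sets of
primes. [cite: StewartYu2001, §4 (proof of Theorem 1), as reconstructed in the module docstring] -/
theorem log_pow_three_le (hK : 1 ≤ K) (hP : PastenApproximationBound K) {C : ℝ} (hC1 : 1 ≤ C)
    (hC : ∀ S : Finset ℕ, (∀ p ∈ S, p.Prime) → ∏ p ∈ S, 4 * K ^ 2 * Real.log p ^ 2 / p ≤ C)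
    {a b c : ℕ} (h : IsABCTriple a b c) (h1 : 1 < a * b) :
    Real.log c ^ 3 ≤ 64 * K ^ 9 * C ^ 3 * max 1 (Real.log (rad a b c : ℕ)) ^ 6 *
      Real.log (max (Real.exp 1) (2 * Real.log c)) ^ 3 * (rad a b c : ℝ) := by
  obtain ⟨ha, hb, habc, hcop⟩ := id h
  have hc : c ≠ 0 := by omega
  have hbc : b.Coprime c := coprime_right_of_isABCTriple h
  have hac : a.Coprime c := coprime_left_of_isABCTriple h
  have habc0 : a * b * c ≠ 0 := by positivity
  have hy0 : 0 ≤ Real.log c := Real.log_nonneg (by exact_mod_cast Nat.one_le_iff_ne_zero.mpr hc)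
  have hY0 : 0 ≤ Real.log (max (Real.exp 1) (2 * Real.log c)) :=
    zero_le_one.trans (one_le_log_max_exp _)
  have hΛ1 : 1 ≤ max 1 (Real.log (rad a b c : ℕ)) := le_max_left _ _
  have hK0 : 0 ≤ K := zero_le_one.trans hK
  -- the three routes
  have hA := log_lt_route_a hK hP h
  have hB := log_lt_route_b hK hP h
  have hCc := log_lt_route_c hK hP h h1
  rw [theta_zero_eq_split K hb.ne' hc hbc] at hA
  rw [theta_zero_eq_split K ha.ne' hc hac] at hB
  rw [theta_zero_eq_split K ha.ne' hb.ne' hcop] at hCc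
  -- per-member accounting
  have hprime : ∀ n : ℕ, ∀ p ∈ n.primeFactors, p.Prime := fun n p hp =>
    Nat.prime_of_mem_primeFactors hp
  have hlogle : ∀ {n : ℕ}, n ∣ a * b * c → ∀ p ∈ n.primeFactors,
      Real.log p ≤ max 1 (Real.log (rad a b c : ℕ)) := by
    intro n hn p hp
    have hp' := Nat.prime_of_mem_primeFactors hp
    have hpR : (p : ℝ) ≤ (rad a b c : ℝ) := by
      exact_mod_cast prime_le_rad hp' ((Nat.dvd_of_mem_primeFactors hp).trans hn) habc0
    have hp0 : (0 : ℝ) < p := by exact_mod_cast hp'.pos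
    exact (Real.log_le_log hp0 hpR).trans (le_max_right _ _)
  have hXa := member_accounting hK hC1 hC hΛ1 a.primeFactors (hprime a)
    (hlogle (Dvd.intro (b * c) (by ring)))
  have hXb := member_accounting hK hC1 hC hΛ1 b.primeFactors (hprime b)
    (hlogle (Dvd.intro (a * c) (by ring)))
  have hXc := member_accounting hK hC1 hC hΛ1 c.primeFactors (hprime c)
    (hlogle (Dvd.intro_left (a * b) rfl))
  -- the radical
  have hRprod : ((rad a b c : ℕ) : ℝ) = (∏ p ∈ a.primeFactors, (p : ℝ)) *
      (∏ p ∈ b.primeFactors, (p : ℝ)) * ∏ p ∈ c.primeFactors, (p : ℝ) := by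
    rw [rad_def, Nat.radical_eq_prod_primeFactors, Nat.cast_prod,
      prod_primeFactors_mul_of_coprime (mul_ne_zero ha.ne' hb.ne') hc (Nat.Coprime.mul_left hac hbc),
      prod_primeFactors_mul_of_coprime ha.ne' hb.ne' hcop]
  have hsum0 : ∀ n : ℕ, 0 ≤ ∑ p ∈ n.primeFactors, ((p : ℕ) : ℝ) := fun n =>
    Finset.sum_nonneg fun p _ => Nat.cast_nonneg p
  have key := cube_combine hK0 hy0 hY0 (hsum0 a) (hsum0 b) (hsum0 c) hA hB hCc hXa hXb hXc
  calc Real.log c ^ 3 ≤ _ := key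
    _ = 64 * K ^ 9 * C ^ 3 * max 1 (Real.log (rad a b c : ℕ)) ^ 6 *
          Real.log (max (Real.exp 1) (2 * Real.log c)) ^ 3 *
          ((∏ p ∈ a.primeFactors, (p : ℝ)) * (∏ p ∈ b.primeFactors, (p : ℝ)) *
            ∏ p ∈ c.primeFactors, (p : ℝ)) := by ring
    _ = _ := by rw [hRprod]

/-- **From the cube to the bound** (pure analysis): if `R ≥ 2`, `K, C ≥ 1` and
`y³ ≤ 64 K⁹ C³ Λ⁶ Y³ R` with `Λ = max(1, log R)`, `Y = log max{e, 2y}`, then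
`y ≤ 64 K³ C (log(16K³C) + 3) · R^{1/3} (log R)³`. [folklore] -/
theorem le_of_cube_le {C R y : ℝ} (hK : 1 ≤ K) (hC : 1 ≤ C) (hR : 2 ≤ R)
    (h : y ^ 3 ≤ 64 * K ^ 9 * C ^ 3 * max 1 (Real.log R) ^ 6 *
      Real.log (max (Real.exp 1) (2 * y)) ^ 3 * R) :
    y ≤ 64 * K ^ 3 * C * (Real.log (16 * K ^ 3 * C) + 3) * R ^ (1 / 3 : ℝ) * Real.log R ^ 3 := by
  set L : ℝ := Real.log R with hL
  set Λ : ℝ := max 1 L with hΛ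
  set Y : ℝ := Real.log (max (Real.exp 1) (2 * y)) with hYdef
  set c₀ : ℝ := Real.log (16 * K ^ 3 * C) with hc₀
  set M : ℝ := 4 * K ^ 3 * C * Λ ^ 2 * R ^ (1 / 3 : ℝ) with hM
  have hR0 : 0 < R := by linarith
  have hK0 : 0 < K := by linarith
  have hC0 : 0 < C := by linarith
  have hY1 : 1 ≤ Y := one_le_log_max_exp _
  have hΛ1 : 1 ≤ Λ := le_max_left _ _
  have hR13 : (R ^ (1 / 3 : ℝ)) ^ 3 = R := by
    rw [← Real.rpow_mul_natCast hR0.le]; norm_num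
  have hR13_1 : 1 ≤ R ^ (1 / 3 : ℝ) := Real.one_le_rpow (by linarith) (by norm_num)
  have hK3 : 1 ≤ K ^ 3 := one_le_pow₀ hK
  have hM1 : 1 ≤ M := by
    have h1 : (1 : ℝ) ≤ 4 * K ^ 3 * C := by nlinarith
    have h2 : (1 : ℝ) ≤ Λ ^ 2 := one_le_pow₀ hΛ1
    calc (1 : ℝ) = 1 * 1 * 1 := by ring
      _ ≤ 4 * K ^ 3 * C * Λ ^ 2 * R ^ (1 / 3 : ℝ) :=
          mul_le_mul (mul_le_mul h1 h2 zero_le_one (by positivity)) hR13_1 zero_le_one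
            (by positivity)
  have hMY : (M * Y) ^ 3 = 64 * K ^ 9 * C ^ 3 * Λ ^ 6 * Y ^ 3 * R := by
    calc (M * Y) ^ 3 = 64 * K ^ 9 * C ^ 3 * Λ ^ 6 * Y ^ 3 * (R ^ (1 / 3 : ℝ)) ^ 3 := by
          rw [hM]; ring
      _ = _ := by rw [hR13]
  have h1 : y ≤ M * Y := by
    refine le_of_pow_le_pow_left₀ (by norm_num : (3 : ℕ) ≠ 0) (by positivity) ?_
    rw [hMY]; exact h
  have h2 : y ≤ 2 * M * Real.log (4 * M) := le_of_le_mul_log_max hM1 h1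
  -- `log(4M) ≤ (c₀ + 3) Λ`
  have hc₀0 : 0 ≤ c₀ := Real.log_nonneg (by nlinarith)
  have hlog4M : Real.log (4 * M) ≤ (c₀ + 3) * Λ := by
    have h4M : 4 * M = (16 * K ^ 3 * C) * (Λ ^ 2 * R ^ (1 / 3 : ℝ)) := by rw [hM]; ring
    have hΛ0 : 0 < Λ := by linarith
    have hx : (16 * K ^ 3 * C) ≠ 0 := by positivity
    have hy' : Λ ^ 2 * R ^ (1 / 3 : ℝ) ≠ 0 := by positivity
    have hexp : Real.log (4 * M) = c₀ + 2 * Real.log Λ + 1 / 3 * L := by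
      rw [h4M, Real.log_mul hx hy', Real.log_mul (x := Λ ^ 2) (y := R ^ (1 / 3 : ℝ)) (by positivity)
        (by positivity), Real.log_pow, Real.log_rpow hR0, hc₀, hL]
      push_cast
      ring
    have hlogΛ : Real.log Λ ≤ Λ := Real.log_le_self hΛ0.le
    have hLΛ : L ≤ Λ := le_max_right _ _
    have hc₀Λ : c₀ ≤ c₀ * Λ := le_mul_of_one_le_right hc₀0 hΛ1
    rw [hexp]
    nlinarith
  -- `Λ ≤ 2 L`
  have hL2 : Real.log 2 ≤ L := Real.log_le_log two_pos hR
  have hlog2 : (1 / 2 : ℝ) ≤ Real.log 2 := by have := Real.log_two_gt_d9; linarith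
  have hL0 : 0 ≤ L := by linarith
  have hΛL : Λ ≤ 2 * L := max_le (by linarith) (by linarith)
  have hM0 : 0 ≤ M := by linarith
  calc y ≤ 2 * M * Real.log (4 * M) := h2
    _ ≤ 2 * M * ((c₀ + 3) * Λ) := mul_le_mul_of_nonneg_left hlog4M (by positivity)
    _ = 8 * K ^ 3 * C * (c₀ + 3) * R ^ (1 / 3 : ℝ) * Λ ^ 3 := by rw [hM]; ring
    _ ≤ 8 * K ^ 3 * C * (c₀ + 3) * R ^ (1 / 3 : ℝ) * (2 * L) ^ 3 := by
        apply mul_le_mul_of_nonneg_left (pow_le_pow_left₀ (by linarith) hΛL 3) (by positivity)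
    _ = 64 * K ^ 3 * C * (c₀ + 3) * R ^ (1 / 3 : ℝ) * L ^ 3 := by ring

/-- **Stewart–Yu 2001, Theorem 1, from the approximation bound.** If `PastenApproximationBound K`
holds for some `K ≥ 1` (lower bounds for linear forms in complex and `p`-adic logarithms over
`ℚ`, in Pasten's form), then `BakerShapeBound (1/3) 3`: there is `κ` with
`log c ≤ κ · R^{1/3} (log R)³` for every abc triple. [cite: StewartYu2001, Theorem 1] -/
theorem bakerShapeBound_third_three_of_approximationBound (hK : 1 ≤ K)
    (hP : PastenApproximationBound K) : BakerShapeBound (1 / 3) 3 := by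
  obtain ⟨C, hC1, hC⟩ := exists_prod_mul_log_sq_div_le (show (0 : ℝ) ≤ 4 * K ^ 2 by positivity)
  refine ⟨64 * K ^ 3 * C * (Real.log (16 * K ^ 3 * C) + 3), fun a b c h => ?_⟩
  obtain ⟨ha, hb, habc, hcop⟩ := id h
  have hR2 : (2 : ℝ) ≤ (rad a b c : ℝ) := by
    have : 2 ≤ rad a b c := by
      rw [rad_def, Nat.two_le_radical_iff]
      calc 2 ≤ c := by omega
        _ ≤ a * b * c := Nat.le_mul_of_pos_left c (Nat.mul_pos ha hb)
    exact_mod_cast this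
  by_cases h1 : 1 < a * b
  · exact le_of_cube_le hK hC1 hR2 (log_pow_three_le hK hP hC1 hC h h1)
  · -- the triple `1 + 1 = 2`
    have hab : a * b = 1 := by
      have : 1 ≤ a * b := Nat.mul_pos ha hb
      omega
    have ha1 : a = 1 := Nat.eq_one_of_mul_eq_one_right hab
    have hb1 : b = 1 := Nat.eq_one_of_mul_eq_one_left hab
    have hc2 : c = 2 := by omega
    set R : ℝ := ((rad a b c : ℕ) : ℝ) with hR
    have hK3 : 1 ≤ K ^ 3 := one_le_pow₀ hK
    have hc₀0 : 0 ≤ Real.log (16 * K ^ 3 * C) := Real.log_nonneg (by nlinarith)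
    have hκ : (192 : ℝ) ≤ 64 * K ^ 3 * C * (Real.log (16 * K ^ 3 * C) + 3) := by
      have h3 : (3 : ℝ) ≤ Real.log (16 * K ^ 3 * C) + 3 := by linarith
      calc (192 : ℝ) = 64 * 1 * 1 * 3 := by norm_num
        _ ≤ 64 * K ^ 3 * C * (Real.log (16 * K ^ 3 * C) + 3) :=
            mul_le_mul (mul_le_mul (mul_le_mul_of_nonneg_left hK3 (by norm_num)) hC1 zero_le_one
              (by positivity)) h3 (by norm_num) (by positivity)
    have hR13 : 1 ≤ R ^ (1 / 3 : ℝ) := Real.one_le_rpow (by linarith) (by norm_num)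
    have hL : (0.69 : ℝ) ≤ Real.log R :=
      le_trans (by have := Real.log_two_gt_d9; linarith) (Real.log_le_log two_pos hR2)
    have hL3 : (0.69 : ℝ) ^ 3 ≤ Real.log R ^ 3 := pow_le_pow_left₀ (by norm_num) hL 3
    have hlog2 : Real.log 2 ≤ 0.7 := by have := Real.log_two_lt_d9; linarith
    calc Real.log c = Real.log 2 := by rw [hc2]; norm_num
      _ ≤ 0.7 := hlog2
      _ ≤ 192 * 1 * (0.69 : ℝ) ^ 3 := by norm_num
      _ ≤ 64 * K ^ 3 * C * (Real.log (16 * K ^ 3 * C) + 3) * R ^ (1 / 3 : ℝ) * Real.log R ^ 3 :=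
          mul_le_mul (mul_le_mul hκ hR13 zero_le_one (by linarith)) hL3 (by norm_num)
            (by positivity)

/-- **`BakerMethodBounds` from the approximation bound** (`BakerMethodBounds` is
`BakerShapeBound (1/3) 3` by definition). [cite: StewartYu2001, Theorem 1] -/
theorem BakerMethodBounds_of_approximationBound (hK : 1 ≤ K) (hP : PastenApproximationBound K) :
    BakerMethodBounds :=
  bakerShapeBound_third_three_of_approximationBound hK hP

/-- **`BakerMethodBounds` from Evertse–Győry's Theorem 4.2.1 over `ℚ`** (Matveev's and Yu's
lower bounds for linear forms in logarithms, combined): the undischarged trust base of the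
barrier declaration is exactly the named fact
`Literature.NumberTheory.DiophantineGeometry.Dioph.evertseGyory_thm_4_2_1_rat`.
[cite: StewartYu2001, Theorem 1] [cite: EvertseGyory2015, Theorem 4.2.1 (p. 68)] -/
theorem BakerMethodBounds_of_evertseGyory (h : evertseGyory_thm_4_2_1_rat) : BakerMethodBounds :=
  BakerMethodBounds_of_approximationBound one_le_pastenK (pasten2024_thm_2_1 h)

/-- **Stewart–Yu 2001, Theorem 1 (`abc.S06`, `Literature.NumberTheory.DiophantineGeometry.stewart_yu`)
from Evertse–Győry's Theorem 4.2.1 over `ℚ`.**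
[cite: StewartYu2001, Theorem 1] [cite: EvertseGyory2015, Theorem 4.2.1 (p. 68)] -/
theorem stewart_yu_of_evertseGyory (h : evertseGyory_thm_4_2_1_rat) :
    Literature.NumberTheory.DiophantineGeometry.stewart_yu :=
  BakerMethodBounds_iff_stewartYu.mp (BakerMethodBounds_of_evertseGyory h)

/-- The Stewart–Tijdeman shape `(15, 0)` from the same fact (through
`stewartTijdeman1986_of_stewartYu`). [cite: EvertseGyory2015, Theorem 4.2.1 (p. 68)] -/
theorem stewartTijdeman1986_of_evertseGyory (h : evertseGyory_thm_4_2_1_rat) :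
    stewartTijdeman1986_upperBound :=
  stewartTijdeman1986_of_stewartYu (stewart_yu_of_evertseGyory h)

end Assembly

/-! ### The 1991 shape from the 2001 shape -/

/-- **Stewart–Yu 1991 from Stewart–Yu 2001.** Waldschmidt's form of the 1991 bound — for every
`ε > 0` there are `κ(ε)`, `c₀(ε)` with `log c ≤ κ(ε) · R^{2/3+ε}` for every abc triple with
`c ≥ c₀(ε)` [cite: Waldschmidt2014, §2 (PDF p. 3)] — follows from Theorem 1 of 2001
(`Literature.NumberTheory.DiophantineGeometry.stewart_yu`, `log c ≤ κ R^{1/3} (log R)³`)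
[cite: StewartYu2001, Theorem 1] by the elementary estimate `log R ≤ 9 R^{1/9}`, i.e.
`(log R)³ ≤ 729 R^{1/3}`, whence `κ R^{1/3} (log R)³ ≤ 729 |κ| R^{2/3} ≤ 729 |κ| R^{2/3+ε}` for
`R ≥ 1`; one may take `κ(ε) = 729 |κ|` and `c₀ = 0`. [folklore] -/
theorem stewartYu1991_of_stewartYu (h : Literature.NumberTheory.DiophantineGeometry.stewart_yu) :
    stewartYu1991_upperBound := by
  obtain ⟨κ, hκ⟩ := h
  intro ε hε
  refine ⟨729 * |κ|, 0, fun a b c ht _ => ?_⟩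
  have h1 := hκ a b c ht
  have hR : (1 : ℝ) ≤ (rad a b c : ℝ) := one_le_rad_real a b c
  set R : ℝ := (rad a b c : ℝ) with hRdef
  have hR0 : 0 < R := by linarith
  have hlog0 : 0 ≤ Real.log R := Real.log_nonneg hR
  -- `log R ≤ 9 R^{1/9}`
  have hlog : Real.log R ≤ 9 * R ^ (1 / 9 : ℝ) := by
    have h := Real.log_le_rpow_div hR0.le (show (0 : ℝ) < 1 / 9 by norm_num)
    have h' : R ^ (1 / 9 : ℝ) / (1 / 9) = 9 * R ^ (1 / 9 : ℝ) := by ring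
    linarith [h'.symm.le]
  -- `(log R)³ ≤ 729 R^{1/3}`
  have hcube : Real.log R ^ 3 ≤ 729 * R ^ (1 / 3 : ℝ) := by
    have h3 : (R ^ (1 / 9 : ℝ)) ^ (3 : ℕ) = R ^ (1 / 3 : ℝ) := by
      rw [← Real.rpow_natCast, ← Real.rpow_mul hR0.le]; norm_num
    calc Real.log R ^ 3 ≤ (9 * R ^ (1 / 9 : ℝ)) ^ 3 := pow_le_pow_left₀ hlog0 hlog 3
      _ = 729 * (R ^ (1 / 9 : ℝ)) ^ (3 : ℕ) := by ring
      _ = 729 * R ^ (1 / 3 : ℝ) := by rw [h3]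
  have h13 : R ^ (1 / 3 : ℝ) * R ^ (1 / 3 : ℝ) = R ^ (2 / 3 : ℝ) := by
    rw [← Real.rpow_add hR0]; norm_num
  have hmono : R ^ (2 / 3 : ℝ) ≤ R ^ (2 / 3 + ε : ℝ) :=
    Real.rpow_le_rpow_of_exponent_le hR (by linarith)
  have hA : 0 ≤ R ^ (1 / 3 : ℝ) * Real.log R ^ 3 := by positivity
  calc Real.log c ≤ κ * R ^ (1 / 3 : ℝ) * Real.log R ^ 3 := h1
    _ ≤ |κ| * (R ^ (1 / 3 : ℝ) * Real.log R ^ 3) := by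
        rw [mul_assoc]; exact mul_le_mul_of_nonneg_right (le_abs_self κ) hA
    _ ≤ |κ| * (R ^ (1 / 3 : ℝ) * (729 * R ^ (1 / 3 : ℝ))) := by
        apply mul_le_mul_of_nonneg_left _ (abs_nonneg κ)
        exact mul_le_mul_of_nonneg_left hcube (by positivity)
    _ = 729 * |κ| * (R ^ (1 / 3 : ℝ) * R ^ (1 / 3 : ℝ)) := by ring
    _ = 729 * |κ| * R ^ (2 / 3 : ℝ) := by rw [h13]
    _ ≤ 729 * |κ| * R ^ (2 / 3 + ε : ℝ) := mul_le_mul_of_nonneg_left hmono (by positivity)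

/-- **Stewart–Yu 1991 (`stewartYu1991_upperBound`) from Evertse–Győry's Theorem 4.2.1 over `ℚ`**,
through `stewart_yu_of_evertseGyory` and `stewartYu1991_of_stewartYu`: the undischarged trust base
of this named fact is the same single fact as for `BakerMethodBounds` and
`stewartTijdeman1986_upperBound`. [cite: Waldschmidt2014, §2 (PDF p. 3)]
[cite: EvertseGyory2015, Theorem 4.2.1 (p. 68)] -/
theorem stewartYu1991_of_evertseGyory (h : evertseGyory_thm_4_2_1_rat) :
    stewartYu1991_upperBound :=
  stewartYu1991_of_stewartYu (stewart_yu_of_evertseGyory h)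

end Literature.Barriers.ABC

end
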